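import Summits.HodgeConjecture.HodgeConjecture.Theorems.F0P6aEReadingsHecke
import HarnessLib

/-!
# `F0P6aEReadings` — ★ RE-HOME of `Lines/F0_P6a_EReadings.lean`, PART 3 of 3 (size-lint split; cut at a declaration boundary).

## Import provenance
- `Theorems.F0P6aEReadingsHecke` = ★ previous part of the same `Lines` workfile `F0_P6a_EReadings` (size-lint split ×3); `HarnessLib`.

See PART 1 `Theorems/F0P6aEReadingsDefs.lean` for the full re-home header and the original module docstring (verbatim there). Namespaces and sections KEPT
(re-opened below exactly as they stand at the cut, with their `open`∕`variable` lines replayed); code bytes = the workfile՚s, docstrings included; options preamble repeated from PART 1.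
HC_CM is proved only modulo the 7 printed citations (2 remaining: hLiu418 = stmt-HodgeConjecture-24832, h413 = stmt-HodgeConjecture-24833) until rung 0 closes; a re-home is count-neutral. -/

set_option autoImplicit false

noncomputable section

namespace Summit.HodgeConjecture.HodgeConjecture.Cruxes.HLiu418.F0P6aEReadings
set_option linter.dupNamespace false  -- `Summit.HodgeConjecture.HodgeConjecture.…` BY DESIGN (D-0017)
open CategoryTheory CategoryTheory.Limits NumberField IsDedekindDomain MulAction
open scoped Matrix Polynomial Pointwise
open Literature.NumberTheory.GaloisRepresentations
open Literature.NumberTheory.Automorphic Literature.NumberTheory.Automorphic.UnitaryGroup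
open Literature.AlgebraicGeometry.ShimuraVarieties.UnitaryCanonicalModel
open Literature.NumberTheory.Automorphic.Liu2021.AppendixC
open Literature.AlgebraicGeometry.Motives (AlgPoints ComplexPoints IntegralModel SchemeOver thickening thickeningGalAction thickeningLift
  thickeningπ baseChange specOver)
open Literature.AlgebraicGeometry.AbelianSchemes (AbelianSchemeOver)
open Literature.AlgebraicGeometry.AbelianSchemes.AbelianSchemeOver (fibreHom RingAction)
open Literature.NumberTheory.DiophantineGeometry (geomResidueField specialFibreFunctor)
open Literature.AlgebraicGeometry.RelativeSpec (ActionOver)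
open Literature.NumberTheory.EllipticCurves (genericFibre)
open Summit.HodgeConjecture.HodgeConjecture.Cruxes.HLiu418.F0P6aModuliDatumDefs
open Summit.HodgeConjecture.HodgeConjecture.Cruxes.HLiu418.F0P6aRGDAssembly
open Summit.HodgeConjecture.HodgeConjecture.Cruxes.HLiu418.F0P6aPELWitnessE (PELWitnessE IsCMTypeThrough)
open Summit.HodgeConjecture.HodgeConjecture.Cruxes.HLiu418.F0P6aIsomSchemeFiniteType (TupleIsoAt₂)


/-- **SOCKET `stub_COVERTRANS`** (LEAD heir F0P6-plan (g3) 02:14:48Z (B), token ask): the Serre-cover transport letter BY VALUE — PAID IN-LINE (LA4-p01 (g0), DEAL v2: two bridges ★ p848009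
`exists_iso_exact_of_tupleRel_id_point`, then ★ p847952 `cover_transport_along_iso` along `(ε⁻¹, ε′⁻¹)`; `IsMonHom` of the bridge iso by ★ `isMonHom_of_isBaseChangeVia_id`). [cite: Shimura1998, §13.1, Theorem 1] [cite: RapoportSmithlingZhang2020Diagonal, §3.2 p. 11, §4.3 p. 20] -/
theorem stub_COVERTRANS : RecordCoverTransport := by
  intro F _ _ _ ι₁ Jstar K₀ S Fi _ _ _ Kc 𝓜 w univ act dual pol g N lvl A₂ ρ₂ D₂ pol₂ lvl₂ gen_iso e e' 𝔞 n y hE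
  -- the two BRIDGES at the sheet points `ℓ_e y`, `ℓ_{e′} y` (★ p848009): group isomorphisms exact on `λ` (both ways), `ι`, level points
  obtain ⟨G, Ĝ, hG⟩ := gen_iso e y
  obtain ⟨G', Ĝ', hG'⟩ := gen_iso e' y
  obtain ⟨ε, hε, -, -, hlam, -, hact, -, hpt⟩ :=
    Literature.AlgebraicGeometry.AbelianSchemes.AbelianSchemeOver.exists_iso_exact_of_tupleRel_id_point
      (thickeningLift e (S.M.obj Kc) y).left _ A₂ _ ρ₂ _ D₂ _ pol₂ _ lvl₂ hG
  obtain ⟨ε', hε', -, -, hlam', -, hact', -, hpt'⟩ :=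
    Literature.AlgebraicGeometry.AbelianSchemes.AbelianSchemeOver.exists_iso_exact_of_tupleRel_id_point
      (thickeningLift e' (S.M.obj Kc) y).left _ A₂ _ ρ₂ _ D₂ _ pol₂ _ lvl₂ hG'
  haveI := hε
  haveI := hε'
  -- the inverse isomorphisms `E-side ≅ spread-side`, typed on the readers (instances found structurally)
  let ε₁ : (schEOf S Kc w e A₂ y).X ≅ (schΩOf S Kc 𝓜 w e univ y).X := ε.symm
  let ε₁' : (schEOf S Kc w e' A₂ y).X ≅ (schΩOf S Kc 𝓜 w e' univ y).X := ε'.symm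
  haveI : IsMonHom ε₁.hom := (inferInstance : IsMonHom ε.inv)
  haveI : IsMonHom ε₁'.hom := (inferInstance : IsMonHom ε'.inv)
  -- transport the E-side cover along `(ε⁻¹, ε′⁻¹)` (★ p847952 `cover_transport_along_iso`, side 1 = E, side 2 = the spread)
  exact Literature.AlgebraicGeometry.AbelianSchemes.AbelianSchemeOver.cover_transport_along_iso
    (dualEOf S Kc w e A₂ D₂ y) (dualΩOf S Kc 𝓜 w e univ dual y) (dualEOf S Kc w e' A₂ D₂ y) (dualΩOf S Kc 𝓜 w e' univ dual y)
    (polEOf S Kc w e A₂ pol₂ y).nonempty_unitHatSlice_iso (polΩOf S Kc 𝓜 w e univ pol y).nonempty_unitHatSlice_iso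
    (polEOf S Kc w e' A₂ pol₂ y).nonempty_unitHatSlice_iso (polΩOf S Kc 𝓜 w e' univ pol y).nonempty_unitHatSlice_iso
    (polEOf S Kc w e A₂ pol₂ y).lam (polΩOf S Kc 𝓜 w e univ pol y).lam (polEOf S Kc w e' A₂ pol₂ y).lam (polΩOf S Kc 𝓜 w e' univ pol y).lam
    (fun a => (actEOf S Kc w e A₂ ρ₂ a y).hom.hom.hom) (fun a => (actΩOf S Kc 𝓜 w e univ act a y).hom.hom.hom)
    (fun a => (actEOf S Kc w e' A₂ ρ₂ a y).hom.hom.hom) (fun a => (actΩOf S Kc 𝓜 w e' univ act a y).hom.hom.hom)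
    (fun a => lvlPtEOf S Kc w e A₂ lvl₂ y a) (fun a => lvlPtΩOf S Kc 𝓜 w e univ lvl y a)
    (fun a => lvlPtEOf S Kc w e' A₂ lvl₂ y a) (fun a => lvlPtΩOf S Kc 𝓜 w e' univ lvl y a)
    (· ∈ 𝔞) (· ∈ (IsCMField.complexConj F) • 𝔞) ((n : ℕ) : 𝓞 F) ε₁ ε₁' n
    hlam hlam' hact hact' hpt hpt' hE

/-- **CONSUMER `heckeRoofsΩ_of_gen_iso`** (sorry-free; binders of the KOTT leaf՚s ★ `kottwitzΩ_of_gen_iso` VERBATIM): the socket `stub_HECKETRANS` applied — the shape the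
leaf `F0_P6a_PELSpread` ED. 2 instantiates as `stub_HECKE … T h := heckeRoofsΩ_of_gen_iso S hU7ₛ hJ hJu Kc 𝓜 w hw T.univ T.act T.dual T.pol T.lvl T.E.P.A T.E.ρ T.E.P.D
T.E.P.pol T.E.P.level T.gen_iso T.pChar T.fDeg h` (`PELHeckeLawAt T` unfolds to `HeckeRoofsΩ … T.univ …`; `genIncl` = the inlined `ι_η` by `rfl`).
[cite: Kottwitz1992, §5 pp. 389–391] [cite: RapoportSmithlingZhang2020Diagonal, §4.1 p. 17, §4.3 (4.23) p. 21] -/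
theorem heckeRoofsΩ_of_gen_iso {F : Type} [Field F] [NumberField F] [IsCMField F] {ι₁ : F →+* ℂ}
    {Jstar : Matrix (Fin 2) (Fin 2) F}
    {K₀ : C5.OpenCompactSubgroup ↥(finAdelic ↥(maximalRealSubfield F) F (IsCMField.complexConj F) 2 Jstar)}
    (S : RecordSystemGS F Jstar ι₁ K₀) (hU7ₛ : S.HeckeTranslateDefinedOver)
    (hJ : (Jstar.map (IsCMField.complexConj F))ᵀ = Jstar) (hJu : IsUnit Jstar)
    {Fi : Type} [Field Fi] [NumberField Fi] [Algebra F Fi] (Kc : C5.SmallLevel K₀)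
    (𝓜 : IntegralModel (𝓞 F) F ((thickening F Fi).obj (S.M.obj Kc))) (w : HeightOneSpectrum (𝓞 F)) (hw : (IsCMField.complexConj F) • w ≠ w)
    (univ : AbelianSchemeOver (𝓜.localise w).total.left) (act : RingAction (𝓞 F) univ) (dual : univ.DualPair)
    (pol : univ.Polarization dual) {g N : ℕ} (lvl : univ.LevelStructure g N)
    (A₂ : AbelianSchemeOver ((baseChange F Fi).obj (S.M.obj Kc)).left) (ρ₂ : RingAction (𝓞 F) A₂) (D₂ : A₂.DualPair)
    (pol₂ : A₂.Polarization D₂) (lvl₂ : A₂.LevelStructure g N)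
    (gen_iso : ∀ (e' : Fi →ₐ[F] AlgebraicClosure (w.adicCompletion F))
      (y : AlgPoints (S.M.obj Kc) (AlgebraicClosure (w.adicCompletion F))),
      letI ιη := (𝓜.localise w).genericIso'.inv.left ≫
        pullback.fst (𝓜.localise w).total.hom
          (Literature.NumberTheory.EllipticCurves.specGenericPoint (HeightOneSpectrum.valuationSubringAtPrime F w) F)
      TupleIsoAt₂ (thickeningLift e' (S.M.obj Kc) y).left
        (univ.baseChange ιη) (act.baseChange ιη) (dual.baseChange ιη) (pol.baseChange ιη) (lvl.baseChange ιη)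
        A₂ ρ₂ D₂ pol₂ lvl₂)
    (pChar fDeg : ℕ)
    (hE : HeckeRoofsE S hU7ₛ hJ hJu Kc w hw A₂ ρ₂ D₂ pol₂ lvl₂ pChar fDeg) :
    HeckeRoofsΩ S hU7ₛ hJ hJu Kc 𝓜 w hw univ act dual pol lvl pChar fDeg :=
  stub_HECKETRANS F ι₁ Jstar K₀ S hU7ₛ hJ hJu Fi Kc 𝓜 w hw univ act dual pol g N lvl A₂ ρ₂ D₂ pol₂ lvl₂ gen_iso pChar fDeg hE

/-- **CONSUMER `coverΩ_of_gen_iso`** (sorry-free): the socket `stub_COVERTRANS` applied at the sheets `e`, `e′`, the ideal `𝔞`, the norm `n` and the point `y` — the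
shape the leaf ED. 2 instantiates inside `stub_TWIST` (the twist data `twistIdeal twistNorm` and the arithmetic rows pass through unchanged).
[cite: Shimura1998, §13.1, Theorem 1] [cite: RapoportSmithlingZhang2020Diagonal, §3.2 p. 11, §4.3 p. 20] -/
theorem coverΩ_of_gen_iso {F : Type} [Field F] [NumberField F] [IsCMField F] {ι₁ : F →+* ℂ}
    {Jstar : Matrix (Fin 2) (Fin 2) F}
    {K₀ : C5.OpenCompactSubgroup ↥(finAdelic ↥(maximalRealSubfield F) F (IsCMField.complexConj F) 2 Jstar)}
    (S : RecordSystemGS F Jstar ι₁ K₀)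
    {Fi : Type} [Field Fi] [NumberField Fi] [Algebra F Fi] (Kc : C5.SmallLevel K₀)
    (𝓜 : IntegralModel (𝓞 F) F ((thickening F Fi).obj (S.M.obj Kc))) (w : HeightOneSpectrum (𝓞 F))
    (univ : AbelianSchemeOver (𝓜.localise w).total.left) (act : RingAction (𝓞 F) univ) (dual : univ.DualPair)
    (pol : univ.Polarization dual) {g N : ℕ} (lvl : univ.LevelStructure g N)
    (A₂ : AbelianSchemeOver ((baseChange F Fi).obj (S.M.obj Kc)).left) (ρ₂ : RingAction (𝓞 F) A₂) (D₂ : A₂.DualPair)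
    (pol₂ : A₂.Polarization D₂) (lvl₂ : A₂.LevelStructure g N)
    (gen_iso : ∀ (e' : Fi →ₐ[F] AlgebraicClosure (w.adicCompletion F))
      (y : AlgPoints (S.M.obj Kc) (AlgebraicClosure (w.adicCompletion F))),
      letI ιη := (𝓜.localise w).genericIso'.inv.left ≫
        pullback.fst (𝓜.localise w).total.hom
          (Literature.NumberTheory.EllipticCurves.specGenericPoint (HeightOneSpectrum.valuationSubringAtPrime F w) F)
      TupleIsoAt₂ (thickeningLift e' (S.M.obj Kc) y).left
        (univ.baseChange ιη) (act.baseChange ιη) (dual.baseChange ιη) (pol.baseChange ιη) (lvl.baseChange ιη)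
        A₂ ρ₂ D₂ pol₂ lvl₂)
    (e e' : Fi →ₐ[F] AlgebraicClosure (w.adicCompletion F)) (𝔞 : Ideal (𝓞 F)) (n : ℕ)
    (y : AlgPoints (S.M.obj Kc) (AlgebraicClosure (w.adicCompletion F)))
    (hE : CoverE S Kc w e A₂ ρ₂ D₂ pol₂ lvl₂ e' 𝔞 n y) :
    CoverΩ S Kc 𝓜 w e univ act dual pol lvl e' 𝔞 n y :=
  stub_COVERTRANS F ι₁ Jstar K₀ S Fi Kc 𝓜 w univ act dual pol g N lvl A₂ ρ₂ D₂ pol₂ lvl₂ gen_iso e e' 𝔞 n y hE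

/-! ## ED. 2 (ADD-ONLY; LEAD «M-57b» (3)∕«M-57c» rows 37∕41, «M-60» (a)(ii)) — §4 the kernel-clause readings: `CoverKerE`, `ETwistKerAt`
(and, once the spine ED. 4 `CoverKerΩ` olean is served, §5 the socket `stub_COVERKERTRANS : RecordCoverKerTransport` + consumer `coverKerΩ_of_gen_iso`).
ED. 1 bytes above are unchanged EXCEPT the three new `import`s and the two ED. 1 sockets, BOTH PAID IN-LINE by LA4-p01 (g0): `stub_COVERTRANS`
(sorry ↦ 30-line proof, M-51 pattern) and `stub_HECKETRANS` (four helpers `roofΩ_of_roofE` ∕ `lineRoofΩ_of_E` ∕ `centralRoofΩ_of_E` ∕ `heckeRoofsAt_of_E` + a 3-line body,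
over ★ `HeckeLinesTransportAlongIso` p848473).  With §5՚s `stub_COVERKERTRANS` also paid, THIS EDITION HAS NO `sorry`: sockets remaining = ∅. -/

set_option maxHeartbeats 400000 in
open scoped MonObj Obj in
/-- (E-ii-5′) **THE SERRE COVER WITH ITS KERNEL CLAUSE `CoverKerE`** — E-twin of the spine ED. 4 `CoverKerΩ` (LEAD «M-57b» (3) Q-COV-KER = (K-law), «M-57c» row 41
`coverKerΩ`): `CoverE` ((t1)–(t5)) ∧ (t1′) «`ker c = A_{ℓ_e y}[𝔞]` on `T`-points: `t ≫ c = 1 ↔ ∀ a ∈ 𝔞, t ≫ ι_{e,y}(a) = 1`» INSIDE THE SAME `∃ c` (the cover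
`c` of (t1)–(t5) is the one whose kernel is read; clause order = GEN spine ED. 4 cand v2 506128d1 `CoverKerΩ` :221 — (t1′) between (t1) and (t2), binder `⦃T : SchemeOver Ω⦄`; P-side feed = door (E)՚s Serre-translate witness + ★ α2a `comp_serreTranslate_eq_one_iff_forall_mem`).  Prototype
tokens (GEN spine ED. 4 cand v2 `CoverKerΩ` spelling wins; reconciled on posting).  NOT asserted by declaring it. [cite: Shimura1998, §13.1, Theorem 1; §18.6]
[cite: RapoportSmithlingZhang2020Diagonal, §3.2 p. 11, §4.3 p. 20] [cite: MumfordAV1970, §7 Thm. 4 (p. 72), §23] -/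
def CoverKerE {F : Type} [Field F] [NumberField F] [IsCMField F] {ι₁ : F →+* ℂ} {Jstar : Matrix (Fin 2) (Fin 2) F}
    {K₀ : C5.OpenCompactSubgroup ↥(finAdelic ↥(maximalRealSubfield F) F (IsCMField.complexConj F) 2 Jstar)}
    (S : RecordSystemGS F Jstar ι₁ K₀) {Fi : Type} [Field Fi] [Algebra F Fi] (Kc : C5.SmallLevel K₀)
    (w : HeightOneSpectrum (𝓞 F))
    (e : Fi →ₐ[F] AlgebraicClosure (w.adicCompletion F))
    (𝒜 : Literature.AlgebraicGeometry.AbelianSchemes.AbelianSchemeOver ((Literature.AlgebraicGeometry.Motives.baseChange F Fi).obj (S.M.obj Kc)).left)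
    (ρ : Literature.AlgebraicGeometry.AbelianSchemes.AbelianSchemeOver.RingAction (𝓞 F) 𝒜)
    (D : 𝒜.DualPair) (pol : 𝒜.Polarization D) {g N : ℕ} (lvl : 𝒜.LevelStructure g N)
    (e' : Fi →ₐ[F] AlgebraicClosure (w.adicCompletion F)) (𝔞 : Ideal (𝓞 F)) (n : ℕ)
    (y : AlgPoints (S.M.obj Kc) (AlgebraicClosure (w.adicCompletion F))) : Prop :=
  ∃ (c : (schEOf S Kc w e 𝒜 y).X ⟶ (schEOf S Kc w e' 𝒜 y).X) (_ : IsMonHom c),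
    -- (t1) Serre presentation of `𝔞`
    (∀ a ∈ 𝔞, ∃ d : (schEOf S Kc w e' 𝒜 y).X ⟶ (schEOf S Kc w e 𝒜 y).X,
        c ≫ d = (actEOf S Kc w e 𝒜 ρ a y).hom.hom.hom ∧ d ≫ c = (actEOf S Kc w e' 𝒜 ρ a y).hom.hom.hom) ∧
    -- (t1′) THE KERNEL CLAUSE `Ker c = A_{e,y}[𝔞]` scheme-theoretically, on all `T`-points (ED. 4, Q-COV-KER (K-law))
    (∀ ⦃T : SchemeOver (AlgebraicClosure (w.adicCompletion F))⦄ (t : T ⟶ (schEOf S Kc w e 𝒜 y).X),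
        t ≫ c = 1 ↔ ∀ a ∈ 𝔞, t ≫ (actEOf S Kc w e 𝒜 ρ a y).hom.hom.hom = 1) ∧
    -- (t2) upper bound through `𝔞̄` and `(n) = 𝔞𝔞̄`
    (∀ b ∈ (IsCMField.complexConj F) • 𝔞, ∃ f : (schEOf S Kc w e 𝒜 y).X ⟶ (schEOf S Kc w e' 𝒜 y).X,
        c ≫ (actEOf S Kc w e' 𝒜 ρ b y).hom.hom.hom = f ≫ (actEOf S Kc w e' 𝒜 ρ (n : 𝓞 F) y).hom.hom.hom) ∧
    -- (t3) polarisations: `c^* λ_{e',y} = n • λ_{e,y}`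
    c ≫ (polEOf S Kc w e' 𝒜 pol y).lam ≫
        Literature.AlgebraicGeometry.AbelianSchemes.AbelianSchemeOver.DualPair.dualIsogenyOver c
          (dualEOf S Kc w e 𝒜 D y) (dualEOf S Kc w e' 𝒜 D y) =
      (polEOf S Kc w e 𝒜 pol y).lam ≫ (dualEOf S Kc w e 𝒜 D y).hat.mulN n ∧
    -- (t4) `𝒪_F`-equivariance
    (∀ a : 𝓞 F, (actEOf S Kc w e 𝒜 ρ a y).hom.hom.hom ≫ c = c ≫ (actEOf S Kc w e' 𝒜 ρ a y).hom.hom.hom) ∧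
    -- (t5) level-`N` points
    (∀ a : Fin g ⊕ Fin g → ZMod N,
        (AlgPoints.map c (lvlPtEOf S Kc w e 𝒜 lvl y a) :
            (fibreEOf S Kc w e' 𝒜 y).Points (AlgebraicClosure (w.adicCompletion F))) = lvlPtEOf S Kc w e' 𝒜 lvl y a)

set_option maxHeartbeats 400000 in
open Summit.HodgeConjecture.HodgeConjecture.Cruxes.HLiu418.F0P6aPELWitnessE (mOf) in
/-- (ED. 2) **LETTER `ETwistKerAt S Kc w e E pChar fDeg` = `ETwistAt` + (π1) `𝔞_{γ_σ} ⊔ 𝔭_{c•w} = ⊤` + the covers WITH KERNEL CLAUSE (`CoverKerE`)** — E-side mirror of the v6g `PELTwistLawAt` rows that are E-EXPRESSIBLE (NOT `frobKernel_banal`, which reads the special fibre and is paid P-side: LA4-p04 ★ p848099∕p848175 + organ #3); v6g-pre 4cde05a0 :236 rows token for token under `T.* ↦ E.*`, `CoverΩ S Kc 𝓜 w ↦ CoverKerE S Kc w`. ORIGINAL ED. 1 TEXT: **LETTER `ETwistAt S Kc w e E pChar fDeg` — THE TWIST IDEALS, THEIR NORMS, THEIR FROBENIUS SHAPE AND THE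 SERRE COVERS OF THE E-WITNESS between the sheets
`e′` and `e′ ∘ γ`**: the rows (a) `(n_γ) = 𝔞_γ 𝔞̄_γ`, (b) `𝔞_γ ⊥ N`, (c) `𝔞_γ ≠ 0`, (FROB-𝔞) `𝔭_w ∣ 𝔞_{γ_σ}` and (FROB-n) `n_{γ_σ} = p^f` for an arithmetic Frobenius `σ`
at `w` reading `γ_σ` on the datum sheet `e` (`σ ∘ e = e ∘ γ_σ`), and the covers `CoverE … e′ … (e′ ∘ γ) 𝔞_γ n_γ y` — the rows of the P-line՚s `PELTwistLawAt T`
VERBATIM with `T.E.N ↦ E.N`, `T.pChar ^ T.fDeg ↦ pChar ^ fDeg`, `CoverΩ … T.univ … ↦ CoverE … E.P.A …`.  The HYPOTHESIS of `coverΩ_of_gen_iso` (§3) ∕ `stub_TWIST`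
(leaf ED. 2); an OBLIGATION of the E-export (Shimura–Taniyama reciprocity on the CM sheets + the adapted-frame arithmetic of `(F, w, Φ)`: `𝔞 := ∏_{τ ∈ Φ_w} ker (residue ∘ τ|_{𝒪_F})`,
`𝔞 𝔞̄ = (p)^{f_w}`, ★ p847313 §2).  NOT asserted. [cite: Shimura1998, §13.1, Theorem 1; §18.6] [cite: Conrad2004GrossZagier, §7, Thm. 7.6]
[cite: RapoportSmithlingZhang2020Diagonal, §3.2 p. 11, §4.3 p. 20] -/
def ETwistKerAt {F : Type} [Field F] [NumberField F] [IsCMField F] {ι₁ : F →+* ℂ} {Jstar : Matrix (Fin 2) (Fin 2) F}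
    {K₀ : C5.OpenCompactSubgroup ↥(finAdelic ↥(maximalRealSubfield F) F (IsCMField.complexConj F) 2 Jstar)}
    (S : RecordSystemGS F Jstar ι₁ K₀) {Fi : Type} [Field Fi] [NumberField Fi] [Algebra F Fi] (Kc : C5.SmallLevel K₀)
    (w : HeightOneSpectrum (𝓞 F)) (e : Fi →ₐ[F] AlgebraicClosure (w.adicCompletion F))
    {τE : Fi →+* ℂ} {Φ : Set (F →+* ℂ)} (E : PELWitnessE F ι₁ Jstar K₀ S Kc Fi τE Φ) (pChar fDeg : ℕ) : Prop :=
  ∃ (twistIdeal : (Fi ≃ₐ[F] Fi) → Ideal (𝓞 F)) (twistNorm : (Fi ≃ₐ[F] Fi) → ℕ),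
    (∀ γ : Fi ≃ₐ[F] Fi, Ideal.span {((twistNorm γ : ℕ) : 𝓞 F)} = twistIdeal γ * (IsCMField.complexConj F) • twistIdeal γ) ∧
    (∀ γ : Fi ≃ₐ[F] Fi, twistIdeal γ ⊔ Ideal.span {((E.N : ℕ) : 𝓞 F)} = ⊤) ∧
    (∀ γ : Fi ≃ₐ[F] Fi, twistIdeal γ ≠ ⊥) ∧
    (∀ (σ : Field.absoluteGaloisGroup (w.adicCompletion F)), IsAbsArithFrob σ → ∀ γ : Fi ≃ₐ[F] Fi,
      ((AlgEquiv.restrictScalars F (Field.absoluteGaloisGroup.toAlgEquiv (w.adicCompletion F) σ) :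
          AlgebraicClosure (w.adicCompletion F) ≃ₐ[F] AlgebraicClosure (w.adicCompletion F)) :
          AlgebraicClosure (w.adicCompletion F) →ₐ[F] AlgebraicClosure (w.adicCompletion F)).comp e = e.comp (γ : Fi →ₐ[F] Fi) →
      w.asIdeal ∣ twistIdeal γ) ∧
    (∀ (σ : Field.absoluteGaloisGroup (w.adicCompletion F)), IsAbsArithFrob σ → ∀ γ : Fi ≃ₐ[F] Fi,
      ((AlgEquiv.restrictScalars F (Field.absoluteGaloisGroup.toAlgEquiv (w.adicCompletion F) σ) :
          AlgebraicClosure (w.adicCompletion F) ≃ₐ[F] AlgebraicClosure (w.adicCompletion F)) :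
          AlgebraicClosure (w.adicCompletion F) →ₐ[F] AlgebraicClosure (w.adicCompletion F)).comp e = e.comp (γ : Fi →ₐ[F] Fi) →
      twistNorm γ = pChar ^ fDeg) ∧
    -- (π1) v6g row `twistIdeal_coprime_conj` (spine ED. 4 row 37, VERBATIM with `T.` dropped): the twist ideal of a Frobenius is prime to `𝔭_{c•w}`
    (∀ (σ : Field.absoluteGaloisGroup (w.adicCompletion F)), IsAbsArithFrob σ → ∀ γ : Fi ≃ₐ[F] Fi,
      ((AlgEquiv.restrictScalars F (Field.absoluteGaloisGroup.toAlgEquiv (w.adicCompletion F) σ) :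
          AlgebraicClosure (w.adicCompletion F) ≃ₐ[F] AlgebraicClosure (w.adicCompletion F)) :
          AlgebraicClosure (w.adicCompletion F) →ₐ[F] AlgebraicClosure (w.adicCompletion F)).comp e = e.comp (γ : Fi →ₐ[F] Fi) →
      twistIdeal γ ⊔ (((IsCMField.complexConj F) • w).asIdeal : Ideal (𝓞 F)) = ⊤) ∧
    -- (FROB-can) ED. 2 — THE SHIMURA–TANIYAMA PIN: at a Frobenius reading the twist ideal IS the canonical twist ideal `𝔞_can(m, τR, w)` of the LIE TYPE
    -- `m = mOf ι₁ Φ (σ₀ ∘ ·)` in the ★ p847883 ∕ organ #4 (`F0P6aCanonicalTwistIdealAsTypeNorm`) TOKEN; `σ₀` is ANY complex embedding of `F̄_w` over `ι₁` (the right-hand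
    -- side is `σ₀`-free for `F∕ℚ` Galois, ★ `comp_eq_comp_of_isGalois`) and `τR` the restriction to `𝒪_F` pinned by `τR_spec` — the junction the `stub_ELAWS` zip `rw`s
    -- through before the row-(7) payment ★ p848302 `frobKernelBanal_canTwistIdeal` (spine F-PIN-can has no D-side consumer and was dropped as a FIELD; it lives HERE, E-side)
    (∀ (σ₀ : AlgebraicClosure (w.adicCompletion F) →+* ℂ), σ₀.comp (algebraMap F (AlgebraicClosure (w.adicCompletion F))) = ι₁ →
      ∀ (τR : (F →+* AlgebraicClosure (w.adicCompletion F)) → (𝓞 F →+* ↥(closureValuationSubring (w.adicCompletion F)))),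
        (∀ (τ : F →+* AlgebraicClosure (w.adicCompletion F)) (x : 𝓞 F),
          ((τR τ x : ↥(closureValuationSubring (w.adicCompletion F))) : AlgebraicClosure (w.adicCompletion F)) = τ (x : F)) →
      ∀ (σ : Field.absoluteGaloisGroup (w.adicCompletion F)), IsAbsArithFrob σ → ∀ γ : Fi ≃ₐ[F] Fi,
        ((AlgEquiv.restrictScalars F (Field.absoluteGaloisGroup.toAlgEquiv (w.adicCompletion F) σ) :
            AlgebraicClosure (w.adicCompletion F) ≃ₐ[F] AlgebraicClosure (w.adicCompletion F)) :
            AlgebraicClosure (w.adicCompletion F) →ₐ[F] AlgebraicClosure (w.adicCompletion F)).comp e = e.comp (γ : Fi →ₐ[F] Fi) →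
        twistIdeal γ = ∏ τ ∈ Finset.univ.filter (fun τ : F →+* AlgebraicClosure (w.adicCompletion F) =>
            mOf ι₁ Φ (σ₀.comp τ) ≠ 0 ∧ RingHom.ker ((IsLocalRing.residue ↥(closureValuationSubring (w.adicCompletion F))).comp (τR τ)) ≠
              (((IsCMField.complexConj F) • w).asIdeal : Ideal (𝓞 F))),
          RingHom.ker ((IsLocalRing.residue ↥(closureValuationSubring (w.adicCompletion F))).comp (τR τ))) ∧
    -- (K-law) v6g row `coverKerΩ` (spine ED. 4 cand v2 row 40, UNGUARDED, LEAD «M-62»; v6g FINAL 3dee9a8d order: BEFORE `coverΩ`) read E-side: the Serre covers WITH kernel clause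
    (∀ (e' : Fi →ₐ[F] AlgebraicClosure (w.adicCompletion F)) (γ : Fi ≃ₐ[F] Fi)
      (y : AlgPoints (S.M.obj Kc) (AlgebraicClosure (w.adicCompletion F))),
      CoverKerE S Kc w e' E.P.A E.ρ E.P.D E.P.pol E.P.level (e'.comp (γ : Fi →ₐ[F] Fi)) (twistIdeal γ) (twistNorm γ) y) ∧
    -- (cover) v6f∕v6g row `coverΩ` read E-side (as in `ETwistAt`; v6g FINAL order: LAST)
    ∀ (e' : Fi →ₐ[F] AlgebraicClosure (w.adicCompletion F)) (γ : Fi ≃ₐ[F] Fi)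
      (y : AlgPoints (S.M.obj Kc) (AlgebraicClosure (w.adicCompletion F))),
      CoverE S Kc w e' E.P.A E.ρ E.P.D E.P.pol E.P.level (e'.comp (γ : Fi →ₐ[F] Fi)) (twistIdeal γ) (twistNorm γ) y

/-! ### §5 (ED. 2) The kernel-clause transport SOCKET `stub_COVERKERTRANS` and its consumer (needs the spine ED. 4 `CoverKerΩ`) -/

/-- (ED. 2) **LETTER `RecordCoverKerTransport` — SERRE COVER TRANSPORT WITH THE KERNEL CLAUSE ALONG THE GENERIC READING** (= `RecordCoverTransport` with `CoverE ↦ CoverKerE`, `CoverΩ ↦ CoverKerΩ` (spine ED. 4); the extra clause (t1′) transports along the isomorphism `ε₁` by `t ≫ c = 1 ↔ …` conjugation — LA4-p01 organ #3 (kernel rider) on top of ★ p847952). ORIGINAL: (by value; same tuple binders and `gen_iso`): the E-side Serre cover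
`CoverE … e … e′ 𝔞 n y` between the sheets `e`, `e′` at `y` gives the cover `CoverΩ … e … e′ 𝔞 n y` of the 𝓨-tuple — conjugate `c`, the `d_a`, `f_b` by the two
isomorphisms `gen_iso e y`, `gen_iso e′ y` ((t1)(t2)(t4) by equivariance, (t3) EXACT `λ` by the polarisation clause of ★ `TupleIsoAt₂` and ★ `dualIsogenyOver` functoriality,
(t5) by the EXACT level clause).  WHY IT MIGHT FAIL: currency only (size S–M).  NOT asserted.
(print: MumfordFogartyKirwan1994, Ch. 7 §2 Definition 7.2 (p. 129)) (print: Shimura1998, §13.1, Theorem 1) (print: RapoportSmithlingZhang2020Diagonal, §3.2 p. 11, §4.3 p. 20) -/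
def RecordCoverKerTransport : Prop :=
  ∀ (F : Type) [Field F] [NumberField F] [IsCMField F] (ι₁ : F →+* ℂ)
    (Jstar : Matrix (Fin 2) (Fin 2) F)
    (K₀ : C5.OpenCompactSubgroup ↥(finAdelic ↥(maximalRealSubfield F) F (IsCMField.complexConj F) 2 Jstar))
    (S : RecordSystemGS F Jstar ι₁ K₀)
    (Fi : Type) [Field Fi] [NumberField Fi] [Algebra F Fi] (Kc : C5.SmallLevel K₀)
    (𝓜 : IntegralModel (𝓞 F) F ((thickening F Fi).obj (S.M.obj Kc))) (w : HeightOneSpectrum (𝓞 F))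
    (univ : AbelianSchemeOver (𝓜.localise w).total.left) (act : RingAction (𝓞 F) univ) (dual : univ.DualPair)
    (pol : univ.Polarization dual) (g N : ℕ) (lvl : univ.LevelStructure g N)
    (A₂ : AbelianSchemeOver ((baseChange F Fi).obj (S.M.obj Kc)).left) (ρ₂ : RingAction (𝓞 F) A₂) (D₂ : A₂.DualPair)
    (pol₂ : A₂.Polarization D₂) (lvl₂ : A₂.LevelStructure g N),
    (∀ (e' : Fi →ₐ[F] AlgebraicClosure (w.adicCompletion F))
      (y : AlgPoints (S.M.obj Kc) (AlgebraicClosure (w.adicCompletion F))),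
      letI ιη := (𝓜.localise w).genericIso'.inv.left ≫
        pullback.fst (𝓜.localise w).total.hom
          (Literature.NumberTheory.EllipticCurves.specGenericPoint (HeightOneSpectrum.valuationSubringAtPrime F w) F)
      TupleIsoAt₂ (thickeningLift e' (S.M.obj Kc) y).left
        (univ.baseChange ιη) (act.baseChange ιη) (dual.baseChange ιη) (pol.baseChange ιη) (lvl.baseChange ιη)
        A₂ ρ₂ D₂ pol₂ lvl₂) →
    ∀ (e e' : Fi →ₐ[F] AlgebraicClosure (w.adicCompletion F)) (𝔞 : Ideal (𝓞 F)) (n : ℕ)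
      (y : AlgPoints (S.M.obj Kc) (AlgebraicClosure (w.adicCompletion F))),
      CoverKerE S Kc w e A₂ ρ₂ D₂ pol₂ lvl₂ e' 𝔞 n y → CoverKerΩ S Kc 𝓜 w e univ act dual pol lvl e' 𝔞 n y

/-- (ED. 2) **SOCKET `stub_COVERKERTRANS`**: the Serre-cover-with-kernel transport letter BY VALUE — PAID IN-LINE (LA4-p01 (g0), DEAL v4 #3: the `stub_COVERTRANS` script with ★ p848359 `coverKer_transport_along_iso` for `cover_transport_along_iso`; the (t1′) clause rides on `hact` via `kernel_clause_transport_along_iso`).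
[cite: Shimura1998, §13.1, Theorem 1] [cite: RapoportSmithlingZhang2020Diagonal, §3.2 p. 11, §4.3 p. 20] -/
theorem stub_COVERKERTRANS : RecordCoverKerTransport := by
  intro F _ _ _ ι₁ Jstar K₀ S Fi _ _ _ Kc 𝓜 w univ act dual pol g N lvl A₂ ρ₂ D₂ pol₂ lvl₂ gen_iso e e' 𝔞 n y hE
  -- the two BRIDGES at the sheet points `ℓ_e y`, `ℓ_{e′} y` (★ p848009): group isomorphisms exact on `λ` (both ways), `ι`, level points
  obtain ⟨G, Ĝ, hG⟩ := gen_iso e y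
  obtain ⟨G', Ĝ', hG'⟩ := gen_iso e' y
  obtain ⟨ε, hε, -, -, hlam, -, hact, -, hpt⟩ :=
    Literature.AlgebraicGeometry.AbelianSchemes.AbelianSchemeOver.exists_iso_exact_of_tupleRel_id_point
      (thickeningLift e (S.M.obj Kc) y).left _ A₂ _ ρ₂ _ D₂ _ pol₂ _ lvl₂ hG
  obtain ⟨ε', hε', -, -, hlam', -, hact', -, hpt'⟩ :=
    Literature.AlgebraicGeometry.AbelianSchemes.AbelianSchemeOver.exists_iso_exact_of_tupleRel_id_point
      (thickeningLift e' (S.M.obj Kc) y).left _ A₂ _ ρ₂ _ D₂ _ pol₂ _ lvl₂ hG'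
  haveI := hε
  haveI := hε'
  -- the inverse isomorphisms `E-side ≅ spread-side`, typed on the readers (instances found structurally)
  let ε₁ : (schEOf S Kc w e A₂ y).X ≅ (schΩOf S Kc 𝓜 w e univ y).X := ε.symm
  let ε₁' : (schEOf S Kc w e' A₂ y).X ≅ (schΩOf S Kc 𝓜 w e' univ y).X := ε'.symm
  haveI : IsMonHom ε₁.hom := (inferInstance : IsMonHom ε.inv)
  haveI : IsMonHom ε₁'.hom := (inferInstance : IsMonHom ε'.inv)
  -- transport the E-side cover WITH ITS KERNEL CLAUSE along `(ε⁻¹, ε′⁻¹)` (★ p848359 `coverKer_transport_along_iso`, side 1 = E, side 2 = the spread)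
  exact Literature.AlgebraicGeometry.AbelianSchemes.AbelianSchemeOver.coverKer_transport_along_iso
    (dualEOf S Kc w e A₂ D₂ y) (dualΩOf S Kc 𝓜 w e univ dual y) (dualEOf S Kc w e' A₂ D₂ y) (dualΩOf S Kc 𝓜 w e' univ dual y)
    (polEOf S Kc w e A₂ pol₂ y).nonempty_unitHatSlice_iso (polΩOf S Kc 𝓜 w e univ pol y).nonempty_unitHatSlice_iso
    (polEOf S Kc w e' A₂ pol₂ y).nonempty_unitHatSlice_iso (polΩOf S Kc 𝓜 w e' univ pol y).nonempty_unitHatSlice_iso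
    (polEOf S Kc w e A₂ pol₂ y).lam (polΩOf S Kc 𝓜 w e univ pol y).lam (polEOf S Kc w e' A₂ pol₂ y).lam (polΩOf S Kc 𝓜 w e' univ pol y).lam
    (fun a => (actEOf S Kc w e A₂ ρ₂ a y).hom.hom.hom) (fun a => (actΩOf S Kc 𝓜 w e univ act a y).hom.hom.hom)
    (fun a => (actEOf S Kc w e' A₂ ρ₂ a y).hom.hom.hom) (fun a => (actΩOf S Kc 𝓜 w e' univ act a y).hom.hom.hom)
    (fun a => lvlPtEOf S Kc w e A₂ lvl₂ y a) (fun a => lvlPtΩOf S Kc 𝓜 w e univ lvl y a)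
    (fun a => lvlPtEOf S Kc w e' A₂ lvl₂ y a) (fun a => lvlPtΩOf S Kc 𝓜 w e' univ lvl y a)
    (· ∈ 𝔞) (· ∈ (IsCMField.complexConj F) • 𝔞) ((n : ℕ) : 𝓞 F) ε₁ ε₁' n
    hlam hlam' hact hact' hpt hpt' hE

/-- (ED. 2) **CONSUMER `coverKerΩ_of_gen_iso`** (sorry-free): the socket `stub_COVERKERTRANS` applied at the sheets `e`, `e′`, the ideal `𝔞`, the norm `n` and the point `y` — the
shape the leaf ED. 2 instantiates inside `stub_TWIST` (the twist data `twistIdeal twistNorm` and the arithmetic rows pass through unchanged).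
[cite: Shimura1998, §13.1, Theorem 1] [cite: RapoportSmithlingZhang2020Diagonal, §3.2 p. 11, §4.3 p. 20] -/
theorem coverKerΩ_of_gen_iso {F : Type} [Field F] [NumberField F] [IsCMField F] {ι₁ : F →+* ℂ}
    {Jstar : Matrix (Fin 2) (Fin 2) F}
    {K₀ : C5.OpenCompactSubgroup ↥(finAdelic ↥(maximalRealSubfield F) F (IsCMField.complexConj F) 2 Jstar)}
    (S : RecordSystemGS F Jstar ι₁ K₀)
    {Fi : Type} [Field Fi] [NumberField Fi] [Algebra F Fi] (Kc : C5.SmallLevel K₀)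
    (𝓜 : IntegralModel (𝓞 F) F ((thickening F Fi).obj (S.M.obj Kc))) (w : HeightOneSpectrum (𝓞 F))
    (univ : AbelianSchemeOver (𝓜.localise w).total.left) (act : RingAction (𝓞 F) univ) (dual : univ.DualPair)
    (pol : univ.Polarization dual) {g N : ℕ} (lvl : univ.LevelStructure g N)
    (A₂ : AbelianSchemeOver ((baseChange F Fi).obj (S.M.obj Kc)).left) (ρ₂ : RingAction (𝓞 F) A₂) (D₂ : A₂.DualPair)
    (pol₂ : A₂.Polarization D₂) (lvl₂ : A₂.LevelStructure g N)
    (gen_iso : ∀ (e' : Fi →ₐ[F] AlgebraicClosure (w.adicCompletion F))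
      (y : AlgPoints (S.M.obj Kc) (AlgebraicClosure (w.adicCompletion F))),
      letI ιη := (𝓜.localise w).genericIso'.inv.left ≫
        pullback.fst (𝓜.localise w).total.hom
          (Literature.NumberTheory.EllipticCurves.specGenericPoint (HeightOneSpectrum.valuationSubringAtPrime F w) F)
      TupleIsoAt₂ (thickeningLift e' (S.M.obj Kc) y).left
        (univ.baseChange ιη) (act.baseChange ιη) (dual.baseChange ιη) (pol.baseChange ιη) (lvl.baseChange ιη)
        A₂ ρ₂ D₂ pol₂ lvl₂)
    (e e' : Fi →ₐ[F] AlgebraicClosure (w.adicCompletion F)) (𝔞 : Ideal (𝓞 F)) (n : ℕ)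
    (y : AlgPoints (S.M.obj Kc) (AlgebraicClosure (w.adicCompletion F)))
    (hE : CoverKerE S Kc w e A₂ ρ₂ D₂ pol₂ lvl₂ e' 𝔞 n y) :
    CoverKerΩ S Kc 𝓜 w e univ act dual pol lvl e' 𝔞 n y :=
  stub_COVERKERTRANS F ι₁ Jstar K₀ S Fi Kc 𝓜 w univ act dual pol g N lvl A₂ ρ₂ D₂ pol₂ lvl₂ gen_iso e e' 𝔞 n y hE

end Summit.HodgeConjecture.HodgeConjecture.Cruxes.HLiu418.F0P6aEReadings

end
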